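import Mathlib
import HarnessLib
import Summits.ResolutionOfSingularities.ResolutionOfSingularities.Theorems.WildQuotientsWildQuotientResolutionBlowupExitConeTransferDepthTwo
import Summits.ResolutionOfSingularities.ResolutionOfSingularities.Theorems.WildQuotientsWildQuotientResolutionJordanFiveI12Stable
import Summits.ResolutionOfSingularities.ResolutionOfSingularities.Theorems.WildQuotientsWildQuotientResolutionAffineQuotientData
import Literature.AlgebraicGeometry.Resolution.BlowupsEquivariant

/-!
# RUNG V5: the `μ₄` DEPTH-TWO cone brick `HP₀` of the J₅ scaffold from a ring-level brick `H₀²`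
(crux stmt-ResolutionOfSingularities-15640 `WildQuotients.WildQuotientResolution`, line `Sketch`;
chain w45c RUNG V5, scaffold `JordanFive.jordanFive_hasResolution_of_bricks` (p527978, brick `HP₀`
l.164–190 of `L/res-L1-w45c-lead-1/stubs/J5Bricks.lean`), `CHAIN.md` v8.2 §0 «HP₀ = stub-4 (β:
reduced centres, two-level toric package)»; [OURS · L1 W4.5c] — NOT a statement of any manuscript;
replaces the role of no printed item. Lead prover res-L1-w45c-lead-1.)

`JordanFive.coneBrick_zero_of_ringBrick₂`: the depth-two scheme-level brick `HP₀` on the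
`μ₄`-vertex chart `V[x_a³] = chart 0` of `V = Bl_{I₁₂} 𝔸ⁿ` — «some blow-up `B` of `V[x_a³]/G`
along the reduced image of the edge surface carries a closed `C` over the image of the `μ₄` vertex
curve with some blow-up of `B` along `𝓘_C` regular» — from the RING-LEVEL brick `H₀²` (binder
below; the V4U pattern `JordanFour.coneBrick_zero_of_ringBrick`, p508076, one floor deeper): for
the chart ratios `T_j = π^*g_j / π^*x_a³` (`j ∉ {0,2,5,13}`: the generators NOT free of `x_b, x_d`)
and `T'_j` (`j ≠ 0`), a presentation `ψ : R₀ → Γ(O₀)` of the invariant ring, a radical `J₀` with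
`√(ψ⁻¹⟨π^*x_a, π^*x_b, π^*x_c, π^*x_d, T_j⟩) = J₀` (reduced edge-surface ideal downstairs), an
ideal `J₀'` with `√(ψ⁻¹⟨π^*x_•, T'_j⟩) = J₀'` (the vertex line), a closed
`C₀ ⊆ Bl_{J₀}(Spec R₀)` over `V(J₀')`, and a regular blow-up of `Bl_{J₀}(Spec R₀)` along `𝓘_{C₀}`.
Transfer: `BlowupExit.exists_isBlowup_depthTwo_of_vertexPresentation` (p530183).
-/

-- single-problem summit: the doubled namespace component `ResolutionOfSingularities` is forced
set_option linter.dupNamespace false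

noncomputable section

open CategoryTheory AlgebraicGeometry TopologicalSpace MvPolynomial
open Literature.AlgebraicGeometry.Resolution Literature.AlgebraicGeometry.RelativeSpec

namespace Summit.ResolutionOfSingularities.ResolutionOfSingularities.Theorems.WildQuotientResolution.JordanFive

-- the statements are long (literal binder types of the scaffold); elaboration needs head-room
set_option maxHeartbeats 4000000 in
/-- **The `μ₄` depth-two cone brick `HP₀` of the RUNG V5 scaffold from the ring-level brick `H₀²`**
(see the module docstring). [OURS · L1 W4.5c] [folklore; assembly of landed decls] -/
theorem coneBrick_zero_of_ringBrick₂ (p : ℕ) (_hp : p.Prime) (_hp5 : 5 ≤ p)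
    (k : Type) [Field k] [CharP k p] (n : ℕ)
    (σ : MvPolynomial (Fin n) k ≃ₐ[k] MvPolynomial (Fin n) k) [Finite ↥(Subgroup.zpowers σ)]
    (a b c d e : Fin n) (hab : a ≠ b) (hac : a ≠ c) (had : a ≠ d) (hae : a ≠ e) (hbc : b ≠ c)
    (hbd : b ≠ d) (hcd : c ≠ d)
    (hb : σ (X b) = X b + X a) (hc : σ (X c) = X c + X b) (hd : σ (X d) = X d + X c)
    (hσ : ∀ i, i ≠ b → i ≠ c → i ≠ d → i ≠ e → σ (X i) = X i)
    (H₀ : ∀ (ρ : ↥(Subgroup.zpowers σ) →* Aut (Spec (CommRingCat.of (MvPolynomial (Fin n) k))))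
      (hρ : ∀ g : ↥(Subgroup.zpowers σ), (ρ g).hom = Spec.map (CommRingCat.ofHom
        ((MulSemiringAction.toRingEquiv (↥(Subgroup.zpowers σ)) (MvPolynomial (Fin n) k) g⁻¹ :
          MvPolynomial (Fin n) k ≃+* MvPolynomial (Fin n) k) :
            MvPolynomial (Fin n) k →+* MvPolynomial (Fin n) k)))
      (ρB : ActionOver
        (affineBlowup.π (I12 k n a b c d) ≫
          Spec.map (CommRingCat.ofHom (algebraMap
            (FixedPoints.subalgebra k (MvPolynomial (Fin n) k) (Subgroup.zpowers σ))
            (MvPolynomial (Fin n) k))))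
        ↥(Subgroup.zpowers σ))
      (_ : ρB.aut = (affineBlowup.isBlowup (I12 k n a b c d)).liftAction ρ
        (idealSheaf_I12_comap k n a b c d hab hac had hbc hbd hcd σ (hσ a hab hac had hae) hb hc hd
          ρ hρ))
      (O₀ : ρB.StableAffineOpens) (_ : O₀.1 = chart k n a b c d 0)
      (hle : ((O₀.1.ι ≫ affineBlowup.π (I12 k n a b c d) ≫
          Spec.map (CommRingCat.ofHom (algebraMap
            (FixedPoints.subalgebra k (MvPolynomial (Fin n) k) (Subgroup.zpowers σ))
            (MvPolynomial (Fin n) k)))) ⁻¹ᵁ ⊤ : (O₀.1 : Scheme.{0}).Opens) ≤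
        O₀.1.ι ⁻¹ᵁ chart k n a b c d 0)
      (T : {j : Fin 40 // j ≠ 0 ∧ j ≠ 2 ∧ j ≠ 5 ∧ j ≠ 13} →
        Γ(affineBlowup (I12 k n a b c d), chart k n a b c d 0))
      (T' : {j : Fin 40 // j ≠ 0} → Γ(affineBlowup (I12 k n a b c d), chart k n a b c d 0))
      (_ : ∀ j, (affineBlowup.π (I12 k n a b c d)).appLE ⊤ (chart k n a b c d 0)
            (blowupChart_le_preimage _ _ _ _)
            ((Scheme.ΓSpecIso (CommRingCat.of (MvPolynomial (Fin n) k))).inv.hom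
              (gens12 k n a b c d j.1)) =
          (affineBlowup.π (I12 k n a b c d)).appLE ⊤ (chart k n a b c d 0)
            (blowupChart_le_preimage _ _ _ _)
            ((Scheme.ΓSpecIso (CommRingCat.of (MvPolynomial (Fin n) k))).inv.hom
              (gens12 k n a b c d 0)) * T j)
      (_ : ∀ j, (affineBlowup.π (I12 k n a b c d)).appLE ⊤ (chart k n a b c d 0)
            (blowupChart_le_preimage _ _ _ _)
            ((Scheme.ΓSpecIso (CommRingCat.of (MvPolynomial (Fin n) k))).inv.hom
              (gens12 k n a b c d j.1)) =
          (affineBlowup.π (I12 k n a b c d)).appLE ⊤ (chart k n a b c d 0)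
            (blowupChart_le_preimage _ _ _ _)
            ((Scheme.ΓSpecIso (CommRingCat.of (MvPolynomial (Fin n) k))).inv.hom
              (gens12 k n a b c d 0)) * T' j),
      ∃ (R₀ : Type) (_ : CommRing R₀) (J₀ J₀' : Ideal R₀)
        (ψ : R₀ →+* Γ((O₀.1 : Scheme.{0}), (O₀.1.ι ≫ affineBlowup.π (I12 k n a b c d) ≫
          Spec.map (CommRingCat.ofHom (algebraMap
            (FixedPoints.subalgebra k (MvPolynomial (Fin n) k) (Subgroup.zpowers σ))
            (MvPolynomial (Fin n) k)))) ⁻¹ᵁ ⊤)),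
        Function.Injective ψ ∧ ψ.range = (ρB.restrict O₀.1 O₀.2.1).invariantsRing ⊤ ∧
        J₀.IsRadical ∧
        ((Ideal.span ((O₀.1.ι.appLE (chart k n a b c d 0)
            ((O₀.1.ι ≫ affineBlowup.π (I12 k n a b c d) ≫
              Spec.map (CommRingCat.ofHom (algebraMap
                (FixedPoints.subalgebra k (MvPolynomial (Fin n) k) (Subgroup.zpowers σ))
                (MvPolynomial (Fin n) k)))) ⁻¹ᵁ ⊤) hle) ''
          (((affineBlowup.π (I12 k n a b c d)).appLE ⊤ (chart k n a b c d 0)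
              (blowupChart_le_preimage _ _ _ _)) ''
            ((Scheme.ΓSpecIso (CommRingCat.of (MvPolynomial (Fin n) k))).inv ''
              {X a, X b, X c, X d}) ∪ Set.range T))).comap ψ).radical = J₀ ∧
        ((Ideal.span ((O₀.1.ι.appLE (chart k n a b c d 0)
            ((O₀.1.ι ≫ affineBlowup.π (I12 k n a b c d) ≫
              Spec.map (CommRingCat.ofHom (algebraMap
                (FixedPoints.subalgebra k (MvPolynomial (Fin n) k) (Subgroup.zpowers σ))
                (MvPolynomial (Fin n) k)))) ⁻¹ᵁ ⊤) hle) ''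
          (((affineBlowup.π (I12 k n a b c d)).appLE ⊤ (chart k n a b c d 0)
              (blowupChart_le_preimage _ _ _ _)) ''
            ((Scheme.ΓSpecIso (CommRingCat.of (MvPolynomial (Fin n) k))).inv ''
              {X a, X b, X c, X d}) ∪ Set.range T'))).comap ψ).radical = J₀' ∧
        ∃ C₀ : Closeds (affineBlowup J₀),
          (∀ x ∈ C₀, (affineBlowup.π J₀).base x ∈ PrimeSpectrum.zeroLocus (J₀' : Set R₀)) ∧
          ∃ (B' : Scheme.{0}) (p' : B' ⟶ affineBlowup J₀),
            IsBlowup p' (Scheme.IdealSheafData.vanishingIdeal C₀) ∧ Scheme.IsRegular B') :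
    ∀ (ρ : ↥(Subgroup.zpowers σ) →* Aut (Spec (CommRingCat.of (MvPolynomial (Fin n) k))))
      (hρ : ∀ g : ↥(Subgroup.zpowers σ), (ρ g).hom = Spec.map (CommRingCat.ofHom
        ((MulSemiringAction.toRingEquiv (↥(Subgroup.zpowers σ)) (MvPolynomial (Fin n) k) g⁻¹ :
          MvPolynomial (Fin n) k ≃+* MvPolynomial (Fin n) k) :
            MvPolynomial (Fin n) k →+* MvPolynomial (Fin n) k)))
      (ρB : ActionOver
        (affineBlowup.π (I12 k n a b c d) ≫
          Spec.map (CommRingCat.ofHom (algebraMap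
            (FixedPoints.subalgebra k (MvPolynomial (Fin n) k) (Subgroup.zpowers σ))
            (MvPolynomial (Fin n) k))))
        ↥(Subgroup.zpowers σ))
      (_ : ρB.aut = (affineBlowup.isBlowup (I12 k n a b c d)).liftAction ρ
        (idealSheaf_I12_comap k n a b c d hab hac had hbc hbd hcd σ (hσ a hab hac had hae) hb hc hd
          ρ hρ))
      (O₀ : ρB.StableAffineOpens) (_ : O₀.1 = chart k n a b c d 0)
      (Z₀ : Closeds (ρB.pieceQuot O₀)),
      (Z₀ : Set (ρB.pieceQuot O₀)) =
        (ρB.pieceMk O₀).base '' (O₀.1.ι.base ⁻¹' edgeSurface k n a b c d) →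
      ∃ (B : Scheme.{0}) (pB : B ⟶ ρB.pieceQuot O₀),
        IsBlowup pB (Scheme.IdealSheafData.vanishingIdeal Z₀) ∧
        ∃ C : Closeds B,
          pB.base '' (C : Set B) ⊆
            (ρB.pieceMk O₀).base '' (O₀.1.ι.base ⁻¹' vertexCurve k n a b c d 0) ∧
          ∃ (B' : Scheme.{0}) (pB' : B' ⟶ B),
            IsBlowup pB' (Scheme.IdealSheafData.vanishingIdeal C) ∧ Scheme.IsRegular B' := by
  classical
  -- notation
  let S : Type := MvPolynomial (Fin n) k
  let I : Ideal S := I12 k n a b c d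
  have hπ : IsBlowup (affineBlowup.π I) (affineBlowup.idealSheaf I) := affineBlowup.isBlowup I
  let ι₀ : S →+* Γ(Spec (CommRingCat.of S), ⊤) := (Scheme.ΓSpecIso (CommRingCat.of S)).inv.hom
  have hIdeal : (affineBlowup.idealSheaf I).ideal ⟨⊤, isAffineOpen_top _⟩ = I.map ι₀ := by
    change (Scheme.IdealSheafData.ofIdealTop _).ideal ⟨⊤, isAffineOpen_top _⟩ = _
    rw [ideal_ofIdealTop_top]
  have hgj : ∀ j : Fin 40, ι₀ (gens12 k n a b c d j) ∈
      (affineBlowup.idealSheaf I).ideal ⟨⊤, isAffineOpen_top _⟩ :=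
    fun j => by rw [hIdeal]; exact Ideal.mem_map_of_mem _ (gens12_mem_I12 k n a b c d j)
  haveI : IsAffine (Spec (CommRingCat.of
    (FixedPoints.subalgebra k (MvPolynomial (Fin n) k) (Subgroup.zpowers σ)))) := inferInstance
  intro ρ hρ ρB haut O₀ hO₀ Z₀ hZ₀
  haveI : IsSeparated (affineBlowup.π I ≫ Spec.map (CommRingCat.ofHom (algebraMap
      (FixedPoints.subalgebra k (MvPolynomial (Fin n) k) (Subgroup.zpowers σ))
      (MvPolynomial (Fin n) k)))) := inferInstance
  have hO : O₀.1 ≤ blowupChart (affineBlowup.π I) (affineBlowup.idealSheaf I)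
      ⟨⊤, isAffineOpen_top _⟩ (ι₀ (gens12 k n a b c d 0)) := le_of_eq hO₀
  have hle : ((O₀.1.ι ≫ affineBlowup.π I ≫ Spec.map (CommRingCat.ofHom (algebraMap
      (FixedPoints.subalgebra k (MvPolynomial (Fin n) k) (Subgroup.zpowers σ))
      (MvPolynomial (Fin n) k)))) ⁻¹ᵁ ⊤ : (O₀.1 : Scheme.{0}).Opens) ≤
      O₀.1.ι ⁻¹ᵁ chart k n a b c d 0 := by
    intro x _
    rw [Scheme.Hom.mem_preimage]
    apply hO
    have hx : O₀.1.ι.base x ∈ Set.range O₀.1.ι.base := ⟨x, rfl⟩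
    rw [Scheme.Opens.range_ι] at hx
    exact hx
  exact BlowupExit.exists_isBlowup_depthTwo_of_vertexPresentation hπ _ ρB (hgj 0)
    (fun j : {j : Fin 40 // j ≠ 0 ∧ j ≠ 2 ∧ j ≠ 5 ∧ j ≠ 13} => ι₀ (gens12 k n a b c d j.1))
    (fun j => hgj j.1)
    (fun j : {j : Fin 40 // j ≠ 0} => ι₀ (gens12 k n a b c d j.1)) (fun j => hgj j.1)
    {X a, X b, X c, X d} O₀ hO hle (H₀ ρ hρ ρB haut O₀ hO₀ hle) Z₀ hZ₀

end Summit.ResolutionOfSingularities.ResolutionOfSingularities.Theorems.WildQuotientResolution.JordanFive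

end
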